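import Summits.Ventures.QEC.CircuitDistance.PortK2DataBB144Z
import Summits.Ventures.QEC.CircuitDistance.K2Chunks
import HarnessLib

/-!
# K2(`[[144,12,12]]`) chunk module — COMPUTATIONAL (native_decide; `Lean.ofReduceBool`)

Cell `qec`, CDX, R146/R152 STEP 1 («computational» header; `ofReduceBool` confined to these chunk modules). Checker of record
`K2.K2Data` (qec-cdx-type-1, PortK2Check); data module of record `PortK2DataBB144X/Z` (p669158/9, crit-1 data audit PASS
2026-08-28T21:20Z); chunk glue `K2Chunks` (idea-1 g2). Cube 1, child 0: leaf group 1 of 3.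
Leaf theorems: the K2 DFS accepts below one descendant state of pivot cube 1 (sector Z); sizes are exact DFS visit counts
(eng-1 g2 `k2count.c`), capped so that the gate's native-axiom audit re-verifies every leaf in place. Assemblies re-derive the
child lists in the kernel (`decide`) and end in the literal cube fact `d144Z.cube (Ts144Z.getD 1 []) (72) (lives144Z.getD 1 0) = true`
(the `hcubes` hypothesis of `K2Inst.k2_complete`). Emitted by qec-cdx-eng-1 g2 (`gen2.py`, idea-1's `gen_k2chunks_from_lean.py` lineage).
-/

namespace Summit.Ventures.QEC.CircuitDistance.K2

set_option maxRecDepth 100000 in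
set_option maxHeartbeats 0 in
set_option exponentiation.threshold 1024 in
/-- K2(144) chunk fact `cube144Z1_ch0_0` (559730 DFS visits; see the module docstring). -/
theorem cube144Z1_ch0_0 : app5 (d144Z.dfs (Ts144Z.getD 1 []) 6) (665235708158150737921, 3264, 21765387119546194789924864, 3, 2348542582773833227889480596789337027375682548908319870707290971532209025114608443441928888898739638596796416) = true := by native_decide

set_option maxRecDepth 100000 in
set_option maxHeartbeats 0 in
set_option exponentiation.threshold 1024 in
/-- K2(144) chunk fact `cube144Z1_ch0_1` (448676 DFS visits; see the module docstring). -/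
theorem cube144Z1_ch0_1 : app5 (d144Z.dfs (Ts144Z.getD 1 []) 6) (665235708158152806400, 3264, 1240362613291092402893750272, 3, 2348542582773833227889480596789337027375682548908319870707290971532209025114608442203988849613359363697672192) = true := by native_decide

set_option maxRecDepth 100000 in
set_option maxHeartbeats 0 in
set_option exponentiation.threshold 1024 in
/-- K2(144) chunk fact `cube144Z1_ch0_2` (464847 DFS visits; see the module docstring). -/
theorem cube144Z1_ch0_2 : app5 (d144Z.dfs (Ts144Z.getD 1 []) 6) (80137051769430605832, 3776, 45671926166590716193867573596389556492242518016, 3, 2348542582773833227889480596789337027375682548908319870707290925860282858523892248338837827229514999449780224) = true := by native_decide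

set_option maxRecDepth 100000 in
set_option maxHeartbeats 0 in
set_option exponentiation.threshold 1024 in
/-- K2(144) chunk fact `cube144Z1_ch0_3` (337223 DFS visits; see the module docstring). -/
theorem cube144Z1_ch0_3 : app5 (d144Z.dfs (Ts144Z.getD 1 []) 6) (3031102693205438660609, 3264, 365375409332725729550923630753076467041977761792, 3, 2348542582773833227889480596789337027375682548908319870707290560484873525798162697417629648158760085466644480) = true := by native_decide

set_option maxRecDepth 100000 in
set_option maxHeartbeats 0 in
set_option exponentiation.threshold 1024 in
/-- K2(144) chunk fact `cube144Z1_ch0_4` (261856 DFS visits; see the module docstring). -/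
theorem cube144Z1_ch0_4 : app5 (d144Z.dfs (Ts144Z.getD 1 []) 6) (964995299355933020192, 576, 23384026197294446691258959746034534026622915313664, 3, 2348542582773833227889480596789337027375682548908319870707267176458676231351471438460306187630445590545956864) = true := by native_decide
end Summit.Ventures.QEC.CircuitDistance.K2
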